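import Summits.KontsevichZagierPeriods.KontsevichZagierPeriods.Theorems.SoloInformedCellBranch
import HarnessLib

/-!
# The band leaves of a cell branch

Solo programme `solo-KontsevichZagierPeriods-informed`, session s110, PRES-RAT(2) step (β)-3.

For a cell branch `γ` (`SoloInformedCellBranch`) and a `K`-interval `[α, α + β] ⊆ [0,1]` over whose
interior the branch stays inside `(0,1)`, a `K`-rational function `N/D` with `D ≠ 0` on the closed
unit square is presentable on the parts of the slab `(α, α + β) × (0,1)` above and below the graph
(`SoloInformedCellBranch.presOn_upper/lower`): the CELL LEAVES of the rescaled unit branch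
(`SoloInformedCellBranch.rescale`, `SoloInformedUnitBranch.presentable_upper/lower`) transported
along the scale move `Λ_{0,a0,b0}` by rule (2) (`soloInformed_presOn_image`).

References: M. Kontsevich, D. Zagier, *Periods* (2001) §1.2.
-/

noncomputable section

open scoped BigOperators Topology
open MeasureTheory Set Metric
open Literature.NumberTheory.Transcendental Literature.NumberTheory.Transcendental.KZ
open Literature.ModelTheory.ExponentialFields (IsSemialgebraic)

namespace Summit.KontsevichZagierPeriods.KontsevichZagierPeriods.Theorems

variable {K : Type*} [Field K] [Algebra K ℝ]

/-! ### The band leaves -/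

namespace SoloInformedCellBranch

section Band

variable (γ : SoloInformedCellBranch K)
  (hK : ∀ c : K, IsAlgebraic ℚ (algebraMap K ℝ c)) (a0 b0 : K)
  (hα : 0 ≤ algebraMap K ℝ a0) (hβ : 0 < algebraMap K ℝ b0)
  (hαβ : algebraMap K ℝ a0 + algebraMap K ℝ b0 ≤ 1)
  (hin : ∀ s : ℝ, 0 < s → s < 1 →
    0 < γ.a (algebraMap K ℝ a0 + algebraMap K ℝ b0 * s) ∧
      γ.a (algebraMap K ℝ a0 + algebraMap K ℝ b0 * s) < 1)
  (N D : MvPolynomial (Fin 2) K)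
  (hD : ∀ y ∈ soloInformedCube 2, (MvPolynomial.aeval y D : ℝ) ≠ 0)

include hα hβ hαβ hD in
/-- The rescaled denominator does not vanish on the closed square. -/
theorem aeval_scaleSubstK_ne_zero {y : Fin 2 → ℝ} (hy : y ∈ soloInformedCube 2) :
    (MvPolynomial.aeval y (soloInformedScaleSubstK 0 a0 b0 D) : ℝ) ≠ 0 := by
  rw [soloInformed_aeval_scaleSubstK]
  exact hD _ (soloInformed_scaleMoveR_zero_mem_cube hα hβ hαβ hy 0)

include hβ in
/-- The pulled-back integrand along `Λ_{0,a0,b0}` is `b0·N(Λ y)/D(Λ y)`. -/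
theorem pullback_integrand (y : Fin 2 → ℝ) :
    (MvPolynomial.aeval (soloInformedScaleMoveR 0 (algebraMap K ℝ a0) (algebraMap K ℝ b0) y) N
        : ℝ) /
        MvPolynomial.aeval (soloInformedScaleMoveR 0 (algebraMap K ℝ a0) (algebraMap K ℝ b0) y) D *
      |(soloInformedScaleDerivR (n := 2) 0 (algebraMap K ℝ b0)).det| =
    (MvPolynomial.aeval y (MvPolynomial.C b0 * soloInformedScaleSubstK 0 a0 b0 N) : ℝ) /
      MvPolynomial.aeval y (soloInformedScaleSubstK 0 a0 b0 D) := by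
  simp only [map_mul, MvPolynomial.aeval_C, soloInformed_aeval_scaleSubstK,
    soloInformed_det_scaleDerivR, abs_of_pos hβ]
  ring

/-- The image of the unit upper band of the rescaled branch is the upper band of the slab. -/
theorem image_upper :
    soloInformedScaleMoveR 0 (algebraMap K ℝ a0) (algebraMap K ℝ b0) ''
        {y | 0 < y 0 ∧ y 0 < 1 ∧ (γ.rescale a0 b0 hα hβ hαβ hin).a (y 0) < y 1 ∧ y 1 < 1} =
      soloInformedBox2Above γ.a (algebraMap K ℝ a0) (algebraMap K ℝ a0 + algebraMap K ℝ b0)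
        0 1 := by
  set α : ℝ := algebraMap K ℝ a0 with hαd
  set β : ℝ := algebraMap K ℝ b0 with hβd
  ext z
  simp only [mem_image, mem_setOf_eq, soloInformedBox2Above, soloInformedBox2]
  constructor
  · rintro ⟨y, ⟨h0, h1, h2, h3⟩, rfl⟩
    rw [rescale_a] at h2
    have hin' := hin (y 0) h0 h1
    rw [soloInformed_scaleMoveR_apply_self,
      soloInformed_scaleMoveR_apply_ne 0 α β y (show (1 : Fin 2) ≠ 0 by decide)]
    refine ⟨⟨⟨by nlinarith, by nlinarith⟩, ⟨by linarith [hin'.1], h3⟩⟩, h2⟩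
  · rintro ⟨⟨⟨h0, h1⟩, ⟨h2, h3⟩⟩, h4⟩
    refine ⟨![(z 0 - α) / β, z 1], ⟨div_pos (by linarith) hβ,
      (div_lt_one hβ).2 (by linarith), ?_, h3⟩, ?_⟩
    · rw [rescale_a]
      simp only [Matrix.cons_val_zero, Matrix.cons_val_one]
      rw [show α + β * ((z 0 - α) / β) = z 0 by field_simp; ring]
      exact h4
    · have hz' : (![z 0, z 1] : Fin 2 → ℝ) = z := by funext i; fin_cases i <;> rfl
      rw [soloInformed_scaleMoveR_zero_vec2, ← hz']
      simp only [Matrix.cons_val_zero, Matrix.cons_val_one]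
      congr 1
      · field_simp
        ring

/-- The image of the unit lower band of the rescaled branch is the lower band of the slab. -/
theorem image_lower :
    soloInformedScaleMoveR 0 (algebraMap K ℝ a0) (algebraMap K ℝ b0) ''
        {y | 0 < y 0 ∧ y 0 < 1 ∧ 0 < y 1 ∧ y 1 < (γ.rescale a0 b0 hα hβ hαβ hin).a (y 0)} =
      soloInformedBox2Below γ.a (algebraMap K ℝ a0) (algebraMap K ℝ a0 + algebraMap K ℝ b0)
        0 1 := by
  set α : ℝ := algebraMap K ℝ a0 with hαd
  set β : ℝ := algebraMap K ℝ b0 with hβd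
  ext z
  simp only [mem_image, mem_setOf_eq, soloInformedBox2Below, soloInformedBox2]
  constructor
  · rintro ⟨y, ⟨h0, h1, h2, h3⟩, rfl⟩
    rw [rescale_a] at h3
    have hin' := hin (y 0) h0 h1
    rw [soloInformed_scaleMoveR_apply_self,
      soloInformed_scaleMoveR_apply_ne 0 α β y (show (1 : Fin 2) ≠ 0 by decide)]
    refine ⟨⟨⟨by nlinarith, by nlinarith⟩, ⟨h2, by linarith [hin'.2]⟩⟩, h3⟩
  · rintro ⟨⟨⟨h0, h1⟩, ⟨h2, h3⟩⟩, h4⟩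
    refine ⟨![(z 0 - α) / β, z 1], ⟨div_pos (by linarith) hβ,
      (div_lt_one hβ).2 (by linarith), h2, ?_⟩, ?_⟩
    · rw [rescale_a]
      simp only [Matrix.cons_val_zero, Matrix.cons_val_one]
      rw [show α + β * ((z 0 - α) / β) = z 0 by field_simp; ring]
      exact h4
    · have hz' : (![z 0, z 1] : Fin 2 → ℝ) = z := by funext i; fin_cases i <;> rfl
      rw [soloInformed_scaleMoveR_zero_vec2, ← hz']
      simp only [Matrix.cons_val_zero, Matrix.cons_val_one]
      congr 1
      · field_simp
        ring

include hK in
/-- The unit upper band of the rescaled branch is `ℚ`-semialgebraic. -/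
theorem isSemialgebraic_unit_upper :
    IsSemialgebraic ℚ
      {y : Fin 2 → ℝ | 0 < y 0 ∧ y 0 < 1 ∧ (γ.rescale a0 b0 hα hβ hαβ hin).a (y 0) < y 1 ∧
        y 1 < 1} := by
  have hO := isSemialgebraic_soloInformedOpenCube 2
  have h := (soloInformed_isSemialgebraicFunOn_aevalK hK hO
    (-soloInformedScaleSubstK 0 a0 b0 γ.H)).isSemialgebraic_sep_neg
  convert h using 1
  ext y
  simp only [mem_setOf_eq, map_neg, neg_lt_zero, soloInformed_aeval_scaleSubstK,
    soloInformed_mem_openCube_iff, Fin.forall_fin_two, rescale_a]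
  have key : ∀ (h0 : 0 < y 0 ∧ y 0 < 1) (h1 : 0 < y 1 ∧ y 1 < 1),
      (γ.a (algebraMap K ℝ a0 + algebraMap K ℝ b0 * y 0) < y 1 ↔
        0 < (MvPolynomial.aeval
          (soloInformedScaleMoveR 0 (algebraMap K ℝ a0) (algebraMap K ℝ b0) y) γ.H : ℝ)) :=
    fun h0 h1 => by
      rw [γ.pos_iff' (soloInformed_scaleMoveR_zero_mem_cube hα hβ hαβ
        (fun j => by fin_cases j <;> [exact ⟨h0.1.le, h0.2.le⟩; exact ⟨h1.1.le, h1.2.le⟩]) 0),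
        soloInformed_scaleMoveR_apply_self,
        soloInformed_scaleMoveR_apply_ne 0 _ _ y (show (1 : Fin 2) ≠ 0 by decide)]
  constructor
  · rintro ⟨h0, h1, h2, h3⟩
    have hin' := hin (y 0) h0 h1
    have h1' : 0 < y 1 ∧ y 1 < 1 := ⟨by linarith [hin'.1], h3⟩
    exact ⟨⟨⟨h0, h1⟩, h1'⟩, (key ⟨h0, h1⟩ h1').1 h2⟩
  · rintro ⟨⟨h0, h1⟩, h⟩
    exact ⟨h0.1, h0.2, (key h0 h1).2 h, h1.2⟩

include hK in
/-- The unit lower band of the rescaled branch is `ℚ`-semialgebraic. -/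
theorem isSemialgebraic_unit_lower :
    IsSemialgebraic ℚ
      {y : Fin 2 → ℝ | 0 < y 0 ∧ y 0 < 1 ∧ 0 < y 1 ∧
        y 1 < (γ.rescale a0 b0 hα hβ hαβ hin).a (y 0)} := by
  have hO := isSemialgebraic_soloInformedOpenCube 2
  have h := (soloInformed_isSemialgebraicFunOn_aevalK hK hO
    (soloInformedScaleSubstK 0 a0 b0 γ.H)).isSemialgebraic_sep_neg
  convert h using 1
  ext y
  simp only [mem_setOf_eq, soloInformed_aeval_scaleSubstK, soloInformed_mem_openCube_iff,
    Fin.forall_fin_two, rescale_a]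
  have key : ∀ (h0 : 0 < y 0 ∧ y 0 < 1) (h1 : 0 < y 1 ∧ y 1 < 1),
      (y 1 < γ.a (algebraMap K ℝ a0 + algebraMap K ℝ b0 * y 0) ↔
        (MvPolynomial.aeval
          (soloInformedScaleMoveR 0 (algebraMap K ℝ a0) (algebraMap K ℝ b0) y) γ.H : ℝ) < 0) :=
    fun h0 h1 => by
      rw [γ.neg_iff' (soloInformed_scaleMoveR_zero_mem_cube hα hβ hαβ
        (fun j => by fin_cases j <;> [exact ⟨h0.1.le, h0.2.le⟩; exact ⟨h1.1.le, h1.2.le⟩]) 0),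
        soloInformed_scaleMoveR_apply_self,
        soloInformed_scaleMoveR_apply_ne 0 _ _ y (show (1 : Fin 2) ≠ 0 by decide)]
  constructor
  · rintro ⟨h0, h1, h2, h3⟩
    have hin' := hin (y 0) h0 h1
    have h1' : 0 < y 1 ∧ y 1 < 1 := ⟨h2, by linarith [hin'.2]⟩
    exact ⟨⟨⟨h0, h1⟩, h1'⟩, (key ⟨h0, h1⟩ h1').1 h3⟩
  · rintro ⟨⟨h0, h1⟩, h⟩
    exact ⟨h0.1, h0.2, h1.1, (key h0 h1).2 h⟩

variable [CharZero K]

include hK hα hβ hαβ hin hD in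
/-- **BAND LEAF, upper.**  A `K`-rational `N/D` with `D ≠ 0` on the closed square is presentable
on the part of the slab `(α, α + β) × (0, 1)` above the graph of the cell branch, provided the
branch stays inside `(0,1)` over `(α, α + β)`. [this work] -/
theorem presOn_upper :
    SoloInformedPresOn
      (soloInformedBox2Above γ.a (algebraMap K ℝ a0) (algebraMap K ℝ a0 + algebraMap K ℝ b0) 0 1)
      (fun y => (MvPolynomial.aeval y N : ℝ) / MvPolynomial.aeval y D) := by
  rw [← γ.image_upper a0 b0 hα hβ hαβ hin]
  have hS := γ.isSemialgebraic_unit_upper hK a0 b0 hα hβ hαβ hin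
  refine soloInformed_presOn_image hS _ (fun _ => soloInformedScaleDerivR 0 (algebraMap K ℝ b0))
    (soloInformed_isSemialgebraicMapOn_scaleMoveK hK 0 a0 b0 hS)
    (fun x _ => (soloInformed_hasFDerivAt_scaleMoveR 0 _ _ x).hasFDerivWithinAt)
    ((soloInformed_scaleMoveR_injective 0 hβ.ne').injOn) ?_ ?_
  · refine (soloInformed_isSemialgebraicFunOn_aevalK hK hS (MvPolynomial.C b0)).congr fun x _ => ?_
    simp only [MvPolynomial.aeval_C, soloInformed_det_scaleDerivR, abs_of_pos hβ]
  · intro ρ hρ hρi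
    refine (γ.rescale a0 b0 hα hβ hαβ hin).presentable_upper hK
      (MvPolynomial.C b0 * soloInformedScaleSubstK 0 a0 b0 N) (soloInformedScaleSubstK 0 a0 b0 D)
      (fun y hy => aeval_scaleSubstK_ne_zero a0 b0 hα hβ hαβ D hD hy) ρ hρ fun y hy => ?_
    rw [hρi (by rw [hρ] at hy; exact hy)]
    exact pullback_integrand a0 b0 hβ N D y

include hK hα hβ hαβ hin hD in
/-- **BAND LEAF, lower.**  A `K`-rational `N/D` with `D ≠ 0` on the closed square is presentable
on the part of the slab `(α, α + β) × (0, 1)` below the graph of the cell branch, provided the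
branch stays inside `(0,1)` over `(α, α + β)`. [this work] -/
theorem presOn_lower :
    SoloInformedPresOn
      (soloInformedBox2Below γ.a (algebraMap K ℝ a0) (algebraMap K ℝ a0 + algebraMap K ℝ b0) 0 1)
      (fun y => (MvPolynomial.aeval y N : ℝ) / MvPolynomial.aeval y D) := by
  rw [← γ.image_lower a0 b0 hα hβ hαβ hin]
  have hS := γ.isSemialgebraic_unit_lower hK a0 b0 hα hβ hαβ hin
  refine soloInformed_presOn_image hS _ (fun _ => soloInformedScaleDerivR 0 (algebraMap K ℝ b0))
    (soloInformed_isSemialgebraicMapOn_scaleMoveK hK 0 a0 b0 hS)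
    (fun x _ => (soloInformed_hasFDerivAt_scaleMoveR 0 _ _ x).hasFDerivWithinAt)
    ((soloInformed_scaleMoveR_injective 0 hβ.ne').injOn) ?_ ?_
  · refine (soloInformed_isSemialgebraicFunOn_aevalK hK hS (MvPolynomial.C b0)).congr fun x _ => ?_
    simp only [MvPolynomial.aeval_C, soloInformed_det_scaleDerivR, abs_of_pos hβ]
  · intro ρ hρ hρi
    refine (γ.rescale a0 b0 hα hβ hαβ hin).presentable_lower hK
      (MvPolynomial.C b0 * soloInformedScaleSubstK 0 a0 b0 N) (soloInformedScaleSubstK 0 a0 b0 D)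
      (fun y hy => aeval_scaleSubstK_ne_zero a0 b0 hα hβ hαβ D hD hy) ρ hρ fun y hy => ?_
    rw [hρi (by rw [hρ] at hy; exact hy)]
    exact pullback_integrand a0 b0 hβ N D y

end Band

end SoloInformedCellBranch

end Summit.KontsevichZagierPeriods.KontsevichZagierPeriods.Theorems
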